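import Mathlib
import HarnessLib
import Literature.Analysis.FluidPDE.TypeIAncientMild
import Literature.Analysis.FluidPDE.AncientLPSLiouvilleMild
import Literature.Analysis.FluidPDE.OseenKernelLp
import Literature.Analysis.FluidPDE.NSBoundedMildOseenDuhamel
import Literature.Analysis.FluidPDE.ForcedOseenMildPeriodic
import Summits.NavierStokesRegularity.NavierStokesRegularity.Theorems.QuarterLogPincerThinCascadeDefs
import Summits.NavierStokesRegularity.NavierStokesRegularity.Theorems.QuarterLogPincerQuietCollarDefs
import Summits.NavierStokesRegularity.NavierStokesRegularity.Theorems.QuarterLogPincerQuietCollarQuasiMildStability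
import Summits.NavierStokesRegularity.NavierStokesRegularity.Theorems.QuarterLogPincerQuietCollarDefectRestart
import Summits.NavierStokesRegularity.NavierStokesRegularity.Theorems.QuarterLogPincerTruncationEdgeShadowing

/-!
# Route `QuarterLogPincer`, crux `TypeIQuantSubcubicExp` (stmt-NavierStokesRegularity-24077), line `quiet_collar` — QP3 tools:
# the `L^∞` HALF (forced sup shadowing of a Tao-frame solution around a Type-I reference with mild defect) and the `L³` Duhamel step

Towards QP3 `ForcedTwoNormShadowing` of ns-idea-7 g9's line `quiet_collar` v1.1 (`Theorems/QuarterLogPincerQuietCollarDefs.lean`); the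
by-name statement `stub_forcedTwoNormShadowing` is assembled in `…QuietCollarShadowing`.

* `exists_forcedSupShadowing` — THE SUP CLAUSE in the shape the line states it: for a reference `V` jointly continuous on
  `[0,1−ε] × ℝ³` with the RATE `‖V(t)‖ ≤ M(1−t)^{−1/2}` and mild defect `≤ η` in sup (`mildDefect`), a datum `u₀` with
  `‖u₀ − V(0)‖ ≤ η`, and a Tao-frame solution `u` on `[0,T']`, `T' ≤ 1−ε`, from `u₀` that is a priori `2`-close to `V`:
  `‖u(t,x) − V(t,x)‖ ≤ 5η·(2/(1−t))^{m+1}`, `m = ⌈64C²(M+2)²⌉` — assembly of `…QuasiMildStability.exists_quasiMild_sub_le_of_typeI`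
  (`u` Oseen-mild between all times by `taoFrame_mild_eq`; `V` quasi-mild from every base time with defect `≤ 2η` by
  `…DefectRestart.quasiMild_of_mildDefect` / `norm_mildDefect_restart_le`; both fields obey the Type-I bound with constant `M+2`).
* `eLpNorm_oseenDuhamel_three_le` — THE `L³` DUHAMEL STEP: `‖B₀(a,c)(t)‖₃, ‖B₀(c,a)(t)‖₃ ≤ 2C₂·sup‖a‖·sup_σ‖c(σ)‖₃` for `t ≤ 1`
  (Minkowski in time `eLpNorm_oseenDuhamel_one_le_lintegral`, the slice bound `exists_eLpNorm_oseenSlice_le` at `p = q = 3`, Hölder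
  `∞ × 3` `eLpNorm_norm_mul_norm_le`, `∫₀ᵗ(t−σ)^{−1/2} = 2√t`), with `eLpNorm_three_le_of_bound_of_two` (`L² ∩ L^∞ ⊂ L³`),
  `exists_measurable_truncation`, `eLpNorm_top_le_of_bound`.

HONEST FRAME: finite-time perturbation theory of ONE hypothetical smooth solution around a reference; nothing here bears on 24077,
the DSS wall W7 or Navier–Stokes regularity (OPEN / not proved).  Helper of the pub-ns-dss typer (g36), `--supports 24077`.
-/

noncomputable section

set_option linter.dupNamespace false

namespace Summit.NavierStokesRegularity.NavierStokesRegularity.Cruxes.TypeIQuantSubcubicExp.QuietCollar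

open MeasureTheory Set Function Filter Real Metric
open scoped ENNReal NNReal Topology
open Literature.Analysis Literature.Analysis.FluidPDE
open Summit.NavierStokesRegularity.NavierStokesRegularity.Theorems.QuarterLogPincerTruncationEdge
  (continuous_slice_of_continuousOn_slab taoFrame_mild_eq)
open Summit.NavierStokesRegularity.NavierStokesRegularity.Cruxes.TypeIQuantSubcubicExp.ThinCascade (TaoFrame)

/-! ## The `L^∞` half of QP3: forced sup shadowing in the Tao frame -/

/-- `M (1−t)^{−1/2} ≤ (M+2)/√(1−t)` and `2 ≤ 2/√(1−t)` bookkeeping: the Type-I form of the bounds. [folklore] -/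
theorem typeI_shape {M t : ℝ} (ht0 : 0 ≤ t) (ht1 : t < 1) :
    M * (1 - t) ^ (-(1 / 2 : ℝ)) = M / Real.sqrt (1 - t) ∧ M / Real.sqrt (1 - t) + 2 ≤ (M + 2) / Real.sqrt (1 - t) := by
  have h1t : 0 < 1 - t := by linarith
  have hs : 0 < Real.sqrt (1 - t) := Real.sqrt_pos.2 h1t
  have hs1 : Real.sqrt (1 - t) ≤ 1 := by
    calc Real.sqrt (1 - t) ≤ Real.sqrt 1 := Real.sqrt_le_sqrt (by linarith)
      _ = 1 := Real.sqrt_one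
  refine ⟨?_, ?_⟩
  · rw [Real.rpow_neg h1t.le, ← Real.sqrt_eq_rpow, div_eq_mul_inv]
  · rw [add_div]
    have : 2 ≤ 2 / Real.sqrt (1 - t) := by
      rw [le_div_iff₀ hs]; nlinarith
    linarith

/-- **FORCED SUP SHADOWING (the `L^∞` clause of QP3 `ForcedTwoNormShadowing`).**  With the universal `C` of
`exists_quasiMild_sub_le_of_typeI` and `m = ⌈64C²(M+2)²⌉`: a reference `V` jointly continuous on `[0,1−ε] × ℝ³` with the
rate `‖V(t)‖ ≤ M(1−t)^{−1/2}` and mild defect `≤ η` in sup, a datum `u₀` `η`-close to `V(0)`, and a Tao-frame solution `u` from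
`u₀` on `[0,T']`, `T' ≤ 1−ε`, that stays `2`-close to `V`, satisfy `‖u(t,x) − V(t,x)‖ ≤ 5η·(2/(1−t))^{m+1}` on `[0,T']`
(`u` is Oseen-mild between all times — `taoFrame_mild_eq`; `V` is quasi-mild from every base time with defect `≤ 2η` —
`quasiMild_of_mildDefect`, `norm_mildDefect_restart_le`; both obey the Type-I bound with constant `M+2`). [folklore] -/
theorem exists_forcedSupShadowing :
    ∃ C : ℝ, 0 < C ∧ ∀ {M ε η T' : ℝ} {V u : ℝ → EuclideanSpace ℝ (Fin 3) → EuclideanSpace ℝ (Fin 3)}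
      {u₀ : EuclideanSpace ℝ (Fin 3) → EuclideanSpace ℝ (Fin 3)} {p : ℝ → EuclideanSpace ℝ (Fin 3) → ℝ},
      0 ≤ M → ε ∈ Set.Ioc (0 : ℝ) (1 / 2) → 0 ≤ η →
      ContinuousOn (uncurry V) (Set.Icc 0 (1 - ε) ×ˢ Set.univ) →
      (∀ t ∈ Set.Icc 0 (1 - ε), ∀ x, ‖V t x‖ ≤ M * (1 - t) ^ (-(1 / 2 : ℝ))) →
      (∀ t ∈ Set.Icc 0 (1 - ε), ∀ x, ‖mildDefect V t x‖ ≤ η) →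
      (∀ x, ‖u₀ x - V 0 x‖ ≤ η) → T' ∈ Set.Ioc (0 : ℝ) (1 - ε) → TaoFrame T' u p → u 0 = u₀ →
      (∀ t ∈ Set.Icc 0 T', ∀ x, ‖u t x - V t x‖ ≤ 2) →
      ∀ t ∈ Set.Icc 0 T', ∀ x,
        ‖u t x - V t x‖ ≤ 5 * η * (2 / (1 - t)) ^ (⌈64 * C ^ 2 * (M + 2) ^ 2⌉₊ + 1) := by
  obtain ⟨C, hC, hchain⟩ := exists_quasiMild_sub_le_of_typeI
  refine ⟨C, hC, ?_⟩
  intro M ε η T' V u u₀ p hM hε hη hVc hVrate hVdef hu₀ hT' hu hu0 hclose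
  have hε0 : 0 < ε := hε.1
  have hTend : 0 < 1 - ε := by linarith [hε.2]
  have hT'0 : 0 < T' := hT'.1
  have hT'1 : T' ≤ 1 - ε := hT'.2
  -- continuity on the slab `[0,T']`
  have hcu : ContinuousOn (uncurry u) (Set.Icc 0 T' ×ˢ Set.univ) := hu.1.smooth_velocity.continuousOn
  have hcv : ContinuousOn (uncurry V) (Set.Icc 0 T' ×ˢ Set.univ) :=
    hVc.mono (prod_mono (Icc_subset_Icc le_rfl hT'1) subset_rfl)
  -- a uniform bound for `V` on `[0, 1−ε]`
  have hVU : ∀ t ∈ Set.Icc 0 (1 - ε), ∀ x, ‖V t x‖ ≤ M * ε ^ (-(1 / 2 : ℝ)) := by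
    intro t ht x
    refine (hVrate t ht x).trans (mul_le_mul_of_nonneg_left ?_ hM)
    exact Real.rpow_le_rpow_of_nonpos hε0 (by linarith [ht.2]) (by norm_num)
  have hU0 : 0 ≤ M * ε ^ (-(1 / 2 : ℝ)) := by positivity
  -- Type-I shape of both fields with constant `M + 2`
  have hvM : ∀ τ ∈ Set.Icc 0 T', ∀ y, ‖V τ y‖ ≤ (M + 2) / Real.sqrt (1 - τ) := by
    intro τ hτ y
    have h := typeI_shape (M := M) (t := τ) hτ.1 (by linarith [hτ.2])
    have := hVrate τ ⟨hτ.1, hτ.2.trans hT'1⟩ y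
    rw [h.1] at this
    linarith [h.2]
  have huM : ∀ τ ∈ Set.Icc 0 T', ∀ y, ‖u τ y‖ ≤ (M + 2) / Real.sqrt (1 - τ) := by
    intro τ hτ y
    have h := typeI_shape (M := M) (t := τ) hτ.1 (by linarith [hτ.2])
    have h1 := hVrate τ ⟨hτ.1, hτ.2.trans hT'1⟩ y
    rw [h.1] at h1
    have h2 : ‖u τ y‖ ≤ ‖V τ y‖ + 2 := by
      have := hclose τ hτ y
      have := norm_le_norm_add_norm_sub' (u τ y) (V τ y)
      linarith [norm_sub_rev (u τ y) (V τ y)]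
    linarith [h.2]
  -- `u` is Oseen-mild between every pair of times; `V` is quasi-mild with defect `≤ 2η` from every base time
  have hmu := taoFrame_mild_eq hu
  have hmv : ∀ s t : ℝ, 0 ≤ s → s < t → t ≤ T' → ∀ x,
      V t x = heatFlow (V s) (t - s) x - oseenDuhamel 1 s V V t x +
        (fun s t x => mildDefect V t x - heatFlow (mildDefect V s) (t - s) x) s t x :=
    fun s t hs hst htT x => quasiMild_of_mildDefect hTend hVc hU0 hVU hs hst (htT.trans hT'1) x
  have hD : ∀ s t : ℝ, 0 ≤ s → s < t → t ≤ T' → ∀ x,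
      ‖(fun s t x => mildDefect V t x - heatFlow (mildDefect V s) (t - s) x) s t x‖ ≤ 2 * η :=
    fun s t hs hst htT x => norm_mildDefect_restart_le hVdef hs hst (htT.trans hT'1) x
  have hinit : ∀ y, ‖u 0 y - V 0 y‖ ≤ η := fun y => by rw [hu0]; exact hu₀ y
  intro t ht x
  have h := hchain hT'0.le (by linarith : T' < 1) hcu hcv hmu hmv hD (by positivity) (by linarith : 0 < M + 2)
    huM hvM hinit t ht x
  have e : (η + 2 * (2 * η)) * (2 * (1 - 0) / (1 - t)) ^ (⌈64 * C ^ 2 * (M + 2) ^ 2⌉₊ + 1) =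
      5 * η * (2 / (1 - t)) ^ (⌈64 * C ^ 2 * (M + 2) ^ 2⌉₊ + 1) := by ring_nf
  rw [e] at h
  exact h

/-! ## `L³` tools -/

/-- `L³` finiteness by interpolation: a continuous `f` with `‖f‖ ≤ B` and `‖f‖₂ ≤ C₂'` has `‖f‖₃ ≤ (B·C₂'²)^{1/3}`. [folklore] -/
theorem eLpNorm_three_le_of_bound_of_two {f : EuclideanSpace ℝ (Fin 3) → EuclideanSpace ℝ (Fin 3)} {B : ℝ} {C2 : ℝ≥0∞}
    (hB : ∀ x, ‖f x‖ ≤ B) (h2 : eLpNorm f 2 volume ≤ C2) :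
    eLpNorm f 3 volume ≤ (ENNReal.ofReal B * C2 ^ 2) ^ (1 / (3 : ℝ)) := by
  have hB0 : 0 ≤ B := (norm_nonneg _).trans (hB 0)
  have h3 : eLpNorm f 3 volume = (∫⁻ x, ‖f x‖ₑ ^ (3 : ℝ)) ^ (1 / (3 : ℝ)) := by
    rw [eLpNorm_eq_lintegral_rpow_enorm_toReal (by norm_num) (by norm_num), ENNReal.toReal_ofNat]
  have h2' : ∫⁻ x, ‖f x‖ₑ ^ (2 : ℝ) = eLpNorm f 2 volume ^ (2 : ℝ) := by
    rw [eLpNorm_eq_lintegral_rpow_enorm_toReal (by norm_num) (by norm_num), ENNReal.toReal_ofNat, ← ENNReal.rpow_mul,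
      show (1 / (2 : ℝ)) * 2 = 1 by norm_num, ENNReal.rpow_one]
  rw [h3]
  refine ENNReal.rpow_le_rpow ?_ (by norm_num)
  calc ∫⁻ x, ‖f x‖ₑ ^ (3 : ℝ) ≤ ∫⁻ x, ENNReal.ofReal B * ‖f x‖ₑ ^ (2 : ℝ) := by
        refine lintegral_mono fun x => ?_
        have hsplit : ‖f x‖ₑ ^ (3 : ℝ) = ‖f x‖ₑ * ‖f x‖ₑ ^ (2 : ℝ) := by
          rw [show (3 : ℝ) = 1 + 2 by norm_num, ENNReal.rpow_add_of_nonneg _ _ (by norm_num) (by norm_num), ENNReal.rpow_one]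
        rw [hsplit]
        have hfx : ‖f x‖ₑ ≤ ENNReal.ofReal B := by
          rw [← ofReal_norm]; exact ENNReal.ofReal_le_ofReal (hB x)
        exact mul_le_mul' hfx le_rfl
    _ = ENNReal.ofReal B * eLpNorm f 2 volume ^ (2 : ℝ) := by rw [lintegral_const_mul' _ _ ENNReal.ofReal_ne_top, h2']
    _ ≤ ENNReal.ofReal B * C2 ^ 2 := by
        rw [show ((2 : ℝ)) = ((2 : ℕ) : ℝ) by norm_num, ENNReal.rpow_natCast]
        gcongr

/-- Slab truncation of a field continuous on `[0,T'] × ℝ³`: jointly measurable, equal to the field on `(0,T')`. [folklore] -/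
theorem exists_measurable_truncation {f : ℝ → EuclideanSpace ℝ (Fin 3) → EuclideanSpace ℝ (Fin 3)} {T' : ℝ}
    (hf : ContinuousOn (uncurry f) (Set.Icc 0 T' ×ˢ Set.univ)) :
    ∃ g : ℝ → EuclideanSpace ℝ (Fin 3) → EuclideanSpace ℝ (Fin 3), Measurable (uncurry g) ∧ ∀ τ ∈ Set.Ioo 0 T', g τ = f τ := by
  refine ⟨fun τ y => (Ioo (0:ℝ) T' ×ˢ (univ : Set (EuclideanSpace ℝ (Fin 3)))).piecewise (uncurry f) (fun _ => 0) (τ, y), ?_, ?_⟩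
  · have : uncurry (fun τ y => (Ioo (0:ℝ) T' ×ˢ (univ : Set (EuclideanSpace ℝ (Fin 3)))).piecewise (uncurry f) (fun _ => 0) (τ, y)) =
        (Ioo (0:ℝ) T' ×ˢ (univ : Set (EuclideanSpace ℝ (Fin 3)))).piecewise (uncurry f) (fun _ => 0) := by
      funext p; rfl
    rw [this]
    exact (hf.mono (prod_mono Ioo_subset_Icc_self subset_rfl)).measurable_piecewise continuousOn_const
      (measurableSet_Ioo.prod MeasurableSet.univ)
  · intro τ hτ; funext y
    exact Set.piecewise_eq_of_mem _ _ _ (mem_prod.2 ⟨hτ, mem_univ y⟩)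

/-- The `L^∞` norm from a pointwise bound. [folklore] -/
theorem eLpNorm_top_le_of_bound {f : EuclideanSpace ℝ (Fin 3) → EuclideanSpace ℝ (Fin 3)} {θ : ℝ} (h : ∀ x, ‖f x‖ ≤ θ) :
    eLpNorm f ∞ volume ≤ ENNReal.ofReal θ := by
  rw [eLpNorm_exponent_top]
  exact eLpNormEssSup_le_of_ae_enorm_bound (Eventually.of_forall fun y => by
    rw [← ofReal_norm]; exact ENNReal.ofReal_le_ofReal (h y))

/-- **The `L³` Duhamel step**: for fields `a, c` jointly continuous on `[0,T'] × ℝ³` with `‖a(σ)‖_∞ ≤ θ` and `‖c(σ)‖₃ ≤ Y` on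
`[0,T']`, `‖B₀(a,c)(t)‖₃ ≤ 2 C₂ θ Y` and `‖B₀(c,a)(t)‖₃ ≤ 2 C₂ θ Y` for `0 < t ≤ T' ≤ 1` (Minkowski in time, the slice bound
`exists_eLpNorm_oseenSlice_le` with `p = q = 3`, Hölder `∞ × 3`, and `∫₀ᵗ (t−σ)^{−1/2} = 2√t ≤ 2`). [folklore] -/
theorem eLpNorm_oseenDuhamel_three_le {C₂ : ℝ} (hC₂0 : 0 ≤ C₂)
    (hS₂ : ∀ {σ : ℝ}, 0 < σ → ∀ {a b : EuclideanSpace ℝ (Fin 3) → EuclideanSpace ℝ (Fin 3)}, AEStronglyMeasurable a volume →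
      AEStronglyMeasurable b volume →
        eLpNorm (fun x => ∫ y, oseenKernel σ (x - y) (a y) (b y)) 3 volume ≤
          ENNReal.ofReal (C₂ * σ ^ (-(1 / 2 : ℝ) -
            (Module.finrank ℝ (EuclideanSpace ℝ (Fin 3)) : ℝ) / 2 * (1 / (3 : ℝ≥0∞).toReal - 1 / (3 : ℝ≥0∞).toReal))) *
            eLpNorm (fun y => ‖a y‖ * ‖b y‖) 3 volume)
    {a c : ℝ → EuclideanSpace ℝ (Fin 3) → EuclideanSpace ℝ (Fin 3)} {T' θ : ℝ} {Y : ℝ≥0∞}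
    (ha : ContinuousOn (uncurry a) (Set.Icc 0 T' ×ˢ Set.univ)) (hc : ContinuousOn (uncurry c) (Set.Icc 0 T' ×ˢ Set.univ))
    (haθ : ∀ σ ∈ Set.Icc 0 T', ∀ x, ‖a σ x‖ ≤ θ) (hcY : ∀ σ ∈ Set.Icc 0 T', eLpNorm (c σ) 3 volume ≤ Y)
    {t : ℝ} (ht0 : 0 < t) (htT : t ≤ T') (ht1 : t ≤ 1) :
    eLpNorm (oseenDuhamel 1 0 a c t) 3 volume ≤ 2 * ENNReal.ofReal C₂ * ENNReal.ofReal θ * Y ∧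
    eLpNorm (oseenDuhamel 1 0 c a t) 3 volume ≤ 2 * ENNReal.ofReal C₂ * ENNReal.ofReal θ * Y := by
  obtain ⟨a', ha'm, ha'⟩ := exists_measurable_truncation ha
  obtain ⟨c', hc'm, hc'⟩ := exists_measurable_truncation hc
  have hθ0 : 0 ≤ θ := (norm_nonneg _).trans (haθ 0 ⟨le_rfl, ht0.le.trans htT⟩ 0)
  -- the slice bound at `σ ∈ (0,t)`
  have hexp : ∀ σ : ℝ, -(1 / 2 : ℝ) - (Module.finrank ℝ (EuclideanSpace ℝ (Fin 3)) : ℝ) / 2 *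
      (1 / (3 : ℝ≥0∞).toReal - 1 / (3 : ℝ≥0∞).toReal) = -(1 / 2 : ℝ) := fun σ => by simp
  have hslice_a : ∀ σ ∈ Set.Icc 0 T', ∀ σ' : ℝ, 0 < σ' →
      eLpNorm (fun x => ∫ y, oseenKernel σ' (x - y) (a σ y) (c σ y)) 3 volume ≤
        ENNReal.ofReal (C₂ * σ' ^ (-(1 / 2 : ℝ))) * (ENNReal.ofReal θ * Y) := by
    intro σ hσ σ' hσ'
    have hca : Continuous (a σ) := continuous_slice_of_continuousOn_slab ha hσ
    have hcc : Continuous (c σ) := continuous_slice_of_continuousOn_slab hc hσ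
    haveI : ENNReal.HolderTriple ⊤ 3 3 := ⟨by simp⟩
    have h1 := hS₂ hσ' hca.aestronglyMeasurable hcc.aestronglyMeasurable
    rw [hexp σ'] at h1
    refine h1.trans (mul_le_mul' le_rfl ?_)
    exact (eLpNorm_norm_mul_norm_le hca.aestronglyMeasurable hcc.aestronglyMeasurable ⊤ 3 3).trans
      (mul_le_mul' (eLpNorm_top_le_of_bound (haθ σ hσ)) (hcY σ hσ))
  have hslice_c : ∀ σ ∈ Set.Icc 0 T', ∀ σ' : ℝ, 0 < σ' →
      eLpNorm (fun x => ∫ y, oseenKernel σ' (x - y) (c σ y) (a σ y)) 3 volume ≤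
        ENNReal.ofReal (C₂ * σ' ^ (-(1 / 2 : ℝ))) * (ENNReal.ofReal θ * Y) := by
    intro σ hσ σ' hσ'
    have hca : Continuous (a σ) := continuous_slice_of_continuousOn_slab ha hσ
    have hcc : Continuous (c σ) := continuous_slice_of_continuousOn_slab hc hσ
    haveI : ENNReal.HolderTriple 3 ⊤ 3 := ⟨by simp⟩
    have h1 := hS₂ hσ' hcc.aestronglyMeasurable hca.aestronglyMeasurable
    rw [hexp σ'] at h1
    refine h1.trans (mul_le_mul' le_rfl ?_)
    refine (eLpNorm_norm_mul_norm_le hcc.aestronglyMeasurable hca.aestronglyMeasurable 3 ⊤ 3).trans ?_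
    rw [mul_comm]
    exact mul_le_mul' (eLpNorm_top_le_of_bound (haθ σ hσ)) (hcY σ hσ)
  -- Minkowski + the time integral
  have hkey : ∀ {f g f' g' : ℝ → EuclideanSpace ℝ (Fin 3) → EuclideanSpace ℝ (Fin 3)},
      Measurable (uncurry f') → Measurable (uncurry g') → (∀ τ ∈ Set.Ioo 0 T', f' τ = f τ) → (∀ τ ∈ Set.Ioo 0 T', g' τ = g τ) →
      (∀ σ ∈ Set.Icc 0 T', ∀ σ' : ℝ, 0 < σ' →
        eLpNorm (fun x => ∫ y, oseenKernel σ' (x - y) (f σ y) (g σ y)) 3 volume ≤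
          ENNReal.ofReal (C₂ * σ' ^ (-(1 / 2 : ℝ))) * (ENNReal.ofReal θ * Y)) →
      eLpNorm (oseenDuhamel 1 0 f g t) 3 volume ≤ 2 * ENNReal.ofReal C₂ * ENNReal.ofReal θ * Y := by
    intro f g f' g' hf'm hg'm hf' hg' hsl
    have heq : oseenDuhamel 1 0 f g t = oseenDuhamel 1 0 f' g' t := by
      funext x
      exact oseenDuhamel_congr_of_eqOn_Ioo (fun τ hτ => (hf' τ ⟨hτ.1, hτ.2.trans_le htT⟩).symm)
        (fun τ hτ => (hg' τ ⟨hτ.1, hτ.2.trans_le htT⟩).symm) x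
    rw [heq]
    refine (eLpNorm_oseenDuhamel_one_le_lintegral hf'm hg'm (by norm_num) (by norm_num) 0 t).trans ?_
    calc ∫⁻ σ in Ioo 0 t, eLpNorm (fun x => ∫ y, oseenKernel (t - σ) (x - y) (f' σ y) (g' σ y)) 3 volume
        ≤ ∫⁻ σ in Ioo 0 t, ENNReal.ofReal (C₂ * (t - σ) ^ (-(1 / 2 : ℝ))) * (ENNReal.ofReal θ * Y) := by
          refine setLIntegral_mono' measurableSet_Ioo fun σ hσ => ?_
          rw [hf' σ ⟨hσ.1, hσ.2.trans_le htT⟩, hg' σ ⟨hσ.1, hσ.2.trans_le htT⟩]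
          exact hsl σ ⟨hσ.1.le, hσ.2.le.trans htT⟩ (t - σ) (sub_pos.2 hσ.2)
      _ = ∫⁻ σ in Ioo 0 t, (ENNReal.ofReal C₂ * (ENNReal.ofReal θ * Y)) * ENNReal.ofReal ((t - σ) ^ (-(1 / 2 : ℝ))) := by
          refine setLIntegral_congr_fun measurableSet_Ioo fun σ hσ => ?_
          rw [ENNReal.ofReal_mul hC₂0]; ring
      _ = (ENNReal.ofReal C₂ * (ENNReal.ofReal θ * Y)) * ENNReal.ofReal (2 * Real.sqrt (t - 0)) := by
          have hmeas : Measurable (fun σ : ℝ => ENNReal.ofReal ((t - σ) ^ (-(1 / 2 : ℝ)))) :=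
            ((measurable_const.sub measurable_id).pow_const _).ennreal_ofReal
          rw [lintegral_const_mul _ hmeas, setLIntegral_Ioo_sub_rpow_neg_half_of_lt ht0]
      _ ≤ (ENNReal.ofReal C₂ * (ENNReal.ofReal θ * Y)) * 2 := by
          refine mul_le_mul' le_rfl ?_
          rw [sub_zero]
          have : 2 * Real.sqrt t ≤ 2 := by
            have h1 : Real.sqrt t ≤ Real.sqrt 1 := Real.sqrt_le_sqrt ht1
            rw [Real.sqrt_one] at h1; linarith
          calc ENNReal.ofReal (2 * Real.sqrt t) ≤ ENNReal.ofReal 2 := ENNReal.ofReal_le_ofReal this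
            _ = 2 := by simp
      _ = 2 * ENNReal.ofReal C₂ * ENNReal.ofReal θ * Y := by ring
  exact ⟨hkey ha'm hc'm ha' hc' hslice_a, hkey hc'm ha'm hc' ha' hslice_c⟩

end Summit.NavierStokesRegularity.NavierStokesRegularity.Cruxes.TypeIQuantSubcubicExp.QuietCollar

end
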